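import Mathlib.MeasureTheory.Integral.IntervalIntegral.FundThmCalculus
import Mathlib.Data.Int.Interval
import HarnessLib

/-!
# Riemann sums over the lattice points of a window — the inequality form of Euler's summation formula

Topic `Literature/Analysis/Quadrature`, a sequel of `RectangularRuleError.lean` (Davis–Rabinowitz §2.1: the rectangular
rules `R_n`, `R̄_n`) and of `Literature.Analysis.Distribution.SchwartzParameterIntegral`
(`norm_riemannSum_sub_intervalIntegral_le`, Banach-valued, modulus of continuity). Those compare `∫ₐᵇ f` with the
Riemann sum on the PARTITION of `[a, b]` into `n` equal panels (the nodes are manufactured from the interval). Here the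
nodes come FIRST — the points `t₀ + kΔ`, `k ∈ ℤ`, of an arithmetic progression (a one-dimensional lattice of spacing
`Δ > 0` and offset `t₀`) — and the window `[T₁, T₂]` is arbitrary (its end points need not be nodes). Everything is
PROVED; values in any complete real normed space `E` (`ℂ`, `ℝ`, `ℝ²`, …).

**Main inequality** (`norm_smul_sum_latticeWindow_sub_integral_le`). For `F : ℝ → E` continuous on `[T₁, T₂]` with a
right derivative `F′` at every interior point, `F′` integrable on the window, and `‖F‖ ≤ M₀` on the window,

  `‖Δ • Σ_{k ∈ ℤ : T₁ ≤ t₀+kΔ ≤ T₂} F(t₀ + kΔ) − ∫_{T₁}^{T₂} F‖ ≤ Δ · (3 M₀ + ∫_{T₁}^{T₂} ‖F′‖)`.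

For `Δ = 1`, `t₀ = 0` this is what one reads off Euler's summation formula
`Σ_{y<n≤x} f(n) = ∫_y^x f + ∫_y^x (t − [t]) f′(t) dt + f(x)([x] − x) − f(y)([y] − y)` [Apostol1976, Thm 3.1 p. 54]
(`0 ≤ t − [t] < 1`); the general case is its affine image, and the proof below is the cell-by-cell form of Apostol's
telescoping (one cell `[t_k, t_k + Δ]` costs `Δ·∫_{cell} ‖F′‖` by the fundamental theorem of calculus; the two ragged ends
and the last node cost `Δ·M₀` each). The error is in TOTAL-VARIATION form `∫‖F′‖` — it implies the cruder
`(T₂ − T₁)·sup ‖F′‖` (`…_of_norm_deriv_le`) and is the form that survives summands whose derivative is large on a short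
range or only integrable (profiles of class `H¹`, decaying weights after a change of variable).

**Also here.** The half-open window `(T₁, T₂]` (`norm_smul_sum_latticeWindowIoc_sub_integral_le`; half-open windows
tile, so sums over adjacent windows add: `sum_latticeWindowIoc_add_sum_latticeWindowIoc`); the bounded-derivative shape
`Δ·(3M₀ + (T₂ − T₁)M₁)` (`…_of_norm_deriv_le`); the sum against `Δ⁻¹ • ∫`
(`norm_sum_latticeWindow_sub_inv_smul_integral_le`); Apostol's unit-spaced form over the integers `1 ≤ n ≤ x`
(`norm_sum_Icc_floor_sub_integral_le`: `‖Σ_{n ≤ x} F(n) − ∫_1^x F‖ ≤ 3M₀ + ∫_1^x ‖F′‖`); the number of lattice points in a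
window (`abs_mul_card_latticeWindow_sub_le`: `|Δ·#W − (T₂ − T₁)| ≤ 3Δ`; `card_latticeWindow_le`,
`sub_one_le_card_latticeWindow`); and the limit forms for a sequence of lattices with spacings `Δ_n → 0` and arbitrary offsets: `Δ_n • Σ → ∫` for a fixed `F`
(`tendsto_smul_sum_latticeWindow`), `Δ_n • Σ F_n − ∫ F_n → 0` for a family `F_n` with uniform bounds
(`tendsto_smul_sum_latticeWindow_sub_integral`, the explicit inequality makes the uniformity free), and the normalised
average `(#W_n)⁻¹ • Σ F_n − (T₂ − T₁)⁻¹ • ∫ F_n → 0` (`tendsto_average_latticeWindow_sub`).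

**What is NOT here.** No higher Euler–Maclaurin terms (the `O(Δ²)` trapezoidal/midpoint corrections of
`RectangularRuleError` need `F″`); no non-equispaced node sets (a `C¹` counting function reduces them to `Δ = 1` by a change
of variable — not typed); no Koksma/discrepancy form for arbitrary point sets (`Literature.Analysis.Quadrature` elsewhere,
Kuipers–Niederreiter Ch. 2); the `n`-dimensional cell argument with a covered frontier is
`Literature.Algebra.EuclideanLattices.norm_sum_sub_integral_le_of_cover` (Marcus, Ch. 6 Lemma 2, weighted).

Cell use (not literature; why this file was typed now): programme F-S3 (landau-siegel), §E row E-102, plan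
`B-det/plan/E102-DISCHARGE.md` v1.4 §2 piece **A0** («Riemann-sum layer»: a deterministic inequality, complex-valued
summands, explicit constants so that stage-dependent summands and node-uniformity come free; then the `Tendsto` and the
normalised forms) — the analytic input for the limit identities `Det.FenceData.Limit` / `ShiftLimit` of
`Literature.NumberTheory.LFunctions.Zhang2022.DetectorFenceStatistic` (sums over the ordinates `2πt₀ + mα` of a model
zero lattice, and unit-spaced sums over Dirichlet-polynomial lengths). Nothing in this file refers to that model.

## References

* T. M. Apostol, *Introduction to Analytic Number Theory*, UTM, Springer (1976), §3.3 Theorem 3.1 (Euler's summation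
  formula), p. 54 [Apostol1976] — read on the page [corpus: book:apostol1976-introduction-analytic-number-theory p0046].
* P. J. Davis, P. Rabinowitz, *Methods of Numerical Integration*, 2nd ed. (1984), §2.1 (2.1.7)–(2.1.9) (rectangular rules
  with a bounded derivative) — the partition form, `RectangularRuleError.lean`.
-/

noncomputable section

open _root_.MeasureTheory _root_.Set Finset Filter intervalIntegral
open scoped _root_.Topology

namespace Literature.Analysis.Quadrature

variable {E : Type*} [NormedAddCommGroup E] [NormedSpace ℝ E] [CompleteSpace E]

/-! ### The lattice points of a window -/

/-- **The lattice indices of a closed window**: the `k ∈ ℤ` with `T₁ ≤ t₀ + kΔ ≤ T₂`, for a lattice of spacing `Δ > 0`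
and offset `t₀` — explicitly `[⌈(T₁ − t₀)/Δ⌉, ⌊(T₂ − t₀)/Δ⌋] ∩ ℤ` (`mem_latticeWindow`). [folklore] -/
def latticeWindow (t₀ Δ T₁ T₂ : ℝ) : Finset ℤ :=
  Finset.Icc ⌈(T₁ - t₀) / Δ⌉ ⌊(T₂ - t₀) / Δ⌋

/-- Membership: `k ∈ latticeWindow t₀ Δ T₁ T₂ ↔ t₀ + kΔ ∈ [T₁, T₂]` (`Δ > 0`) — Apostol's `m = [y]`, `k = [x]`
bookkeeping at spacing `Δ`. [cite: Apostol1976, Thm 3.1 p. 54 (proof)] -/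
theorem mem_latticeWindow {t₀ Δ T₁ T₂ : ℝ} (hΔ : 0 < Δ) {k : ℤ} :
    k ∈ latticeWindow t₀ Δ T₁ T₂ ↔ t₀ + k * Δ ∈ Set.Icc T₁ T₂ := by
  rw [latticeWindow, Finset.mem_Icc, Int.ceil_le, Int.le_floor, div_le_iff₀ hΔ, le_div_iff₀ hΔ, Set.mem_Icc]
  constructor <;> rintro ⟨h1, h2⟩ <;> constructor <;> linarith

/-- **The lattice indices of a half-open window**: the `k ∈ ℤ` with `T₁ < t₀ + kΔ ≤ T₂` — explicitly
`[⌊(T₁ − t₀)/Δ⌋ + 1, ⌊(T₂ − t₀)/Δ⌋] ∩ ℤ` (`mem_latticeWindowIoc`). Half-open windows tile: for `T₁ ≤ T₂ ≤ T₃` the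
index sets of `(T₁, T₂]` and `(T₂, T₃]` are disjoint with union that of `(T₁, T₃]`. [folklore] -/
def latticeWindowIoc (t₀ Δ T₁ T₂ : ℝ) : Finset ℤ :=
  Finset.Icc (⌊(T₁ - t₀) / Δ⌋ + 1) ⌊(T₂ - t₀) / Δ⌋

/-- Membership: `k ∈ latticeWindowIoc t₀ Δ T₁ T₂ ↔ t₀ + kΔ ∈ (T₁, T₂]` (`Δ > 0`) — Apostol's range `y < n ≤ x`,
`n = [y] + 1, …, [x]`, at spacing `Δ`. [cite: Apostol1976, Thm 3.1 p. 54 (proof)] -/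
theorem mem_latticeWindowIoc {t₀ Δ T₁ T₂ : ℝ} (hΔ : 0 < Δ) {k : ℤ} :
    k ∈ latticeWindowIoc t₀ Δ T₁ T₂ ↔ t₀ + k * Δ ∈ Set.Ioc T₁ T₂ := by
  rw [latticeWindowIoc, Finset.mem_Icc, Int.add_one_le_iff, Int.floor_lt, Int.le_floor, div_lt_iff₀ hΔ,
    le_div_iff₀ hΔ, Set.mem_Ioc]
  constructor <;> rintro ⟨h1, h2⟩ <;> constructor <;> linarith

/-- Half-open windows tile: for `T₁ ≤ T₂ ≤ T₃` the index set of `(T₁, T₃]` is the DISJOINT union of those of `(T₁, T₂]`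
and `(T₂, T₃]`, so lattice sums over adjacent half-open windows add. [cite: Apostol1976, Thm 3.1 p. 54] -/
theorem sum_latticeWindowIoc_add_sum_latticeWindowIoc {M : Type*} [AddCommMonoid M] {t₀ Δ T₁ T₂ T₃ : ℝ}
    (hΔ : 0 < Δ) (h12 : T₁ ≤ T₂) (h23 : T₂ ≤ T₃) (f : ℤ → M) :
    ∑ k ∈ latticeWindowIoc t₀ Δ T₁ T₂, f k + ∑ k ∈ latticeWindowIoc t₀ Δ T₂ T₃, f k
      = ∑ k ∈ latticeWindowIoc t₀ Δ T₁ T₃, f k := by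
  classical
  rw [← Finset.sum_union]
  · congr 1
    ext k
    simp only [Finset.mem_union, mem_latticeWindowIoc hΔ, Set.mem_Ioc]
    constructor
    · rintro (⟨h1, h2⟩ | ⟨h1, h2⟩)
      · exact ⟨h1, h2.trans h23⟩
      · exact ⟨lt_of_le_of_lt h12 h1, h2⟩
    · rintro ⟨h1, h2⟩
      rcases le_or_gt (t₀ + k * Δ) T₂ with h | h
      · exact Or.inl ⟨h1, h⟩
      · exact Or.inr ⟨h, h2⟩
  · rw [Finset.disjoint_left]
    intro k hk hk'
    rw [mem_latticeWindowIoc hΔ, Set.mem_Ioc] at hk hk'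
    linarith [hk.2, hk'.1]

/-! ### One cell, and a run of consecutive cells -/

/-- **One cell.** For `T₁ ≤ u ≤ v ≤ T₂`: `‖(v − u) • F(u) − ∫_u^v F‖ ≤ (v − u)·∫_u^v ‖F′‖` — since
`F(t) − F(u) = ∫_u^t F′` on the cell (fundamental theorem of calculus with a right derivative).
[cite: Apostol1976, Thm 3.1 p. 54 (proof, one cell of the telescoping)] -/
theorem norm_smul_sub_integral_cell_le {F F' : ℝ → E} {T₁ T₂ u v : ℝ} (h1 : T₁ ≤ u) (huv : u ≤ v)
    (h2 : v ≤ T₂) (hF : ContinuousOn F (Set.Icc T₁ T₂))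
    (hF' : ∀ t ∈ Set.Ioo T₁ T₂, HasDerivWithinAt F (F' t) (Set.Ioi t) t)
    (hint : IntervalIntegrable F' volume T₁ T₂) :
    ‖(v - u) • F u - ∫ t in u..v, F t‖ ≤ (v - u) * ∫ t in u..v, ‖F' t‖ := by
  have huI : u ∈ Set.Icc T₁ T₂ := ⟨h1, huv.trans h2⟩
  have hvI : v ∈ Set.Icc T₁ T₂ := ⟨h1.trans huv, h2⟩
  have hsub : Set.uIcc u v ⊆ Set.Icc T₁ T₂ := Set.uIcc_subset_Icc huI hvI
  have hFi : IntervalIntegrable F volume u v := (hF.mono hsub).intervalIntegrable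
  have hint' : IntervalIntegrable F' volume u v := hint.mono_set (by
    rw [Set.uIcc_of_le (h1.trans (huv.trans h2))]; exact hsub)
  have hnint : IntervalIntegrable (fun t => ‖F' t‖) volume u v := hint'.norm
  -- the oscillation on the cell is at most `∫_u^v ‖F′‖`
  have hosc : ∀ t ∈ Set.Icc u v, ‖F u - F t‖ ≤ ∫ s in u..v, ‖F' s‖ := by
    intro t ht
    have htI : t ∈ Set.Icc T₁ T₂ := ⟨h1.trans ht.1, ht.2.trans h2⟩
    have hsub' : Set.uIcc u t ⊆ Set.Icc T₁ T₂ := Set.uIcc_subset_Icc huI htI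
    have hint'' : IntervalIntegrable F' volume u t := hint.mono_set (by
      rw [Set.uIcc_of_le (h1.trans (huv.trans h2))]; exact hsub')
    have hftc : ∫ s in u..t, F' s = F t - F u :=
      integral_eq_sub_of_hasDeriv_right_of_le ht.1 (hF.mono (Set.Icc_subset_Icc h1 (ht.2.trans h2)))
        (fun s hs => hF' s ⟨lt_of_le_of_lt h1 hs.1, lt_of_lt_of_le hs.2 (ht.2.trans h2)⟩) hint''
    calc ‖F u - F t‖ = ‖∫ s in u..t, F' s‖ := by rw [hftc, norm_sub_rev]
      _ ≤ ∫ s in u..t, ‖F' s‖ := norm_integral_le_integral_norm ht.1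
      _ ≤ ∫ s in u..v, ‖F' s‖ :=
          integral_mono_interval le_rfl ht.1 ht.2 (Eventually.of_forall fun _ => norm_nonneg _) hnint
  have hconst : (v - u) • F u = ∫ _ in u..v, F u := by rw [intervalIntegral.integral_const]
  rw [hconst, ← intervalIntegral.integral_sub intervalIntegrable_const hFi]
  calc ‖∫ t in u..v, F u - F t‖ ≤ ∫ t in u..v, ‖F u - F t‖ := norm_integral_le_integral_norm huv
    _ ≤ ∫ _ in u..v, (∫ s in u..v, ‖F' s‖) :=
        intervalIntegral.integral_mono_on huv ((intervalIntegrable_const.sub hFi).norm)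
          intervalIntegrable_const hosc
    _ = (v - u) * ∫ s in u..v, ‖F' s‖ := by rw [intervalIntegral.integral_const, smul_eq_mul]

/-- **A run of consecutive cells** (the core of the telescoping): nodes `c + iΔ`, `i = 0, …, N`, inside `[T₁, T₂]` with
ragged ends of length `≤ Δ` (`c ≤ T₁ + Δ`, `T₂ ≤ c + NΔ + Δ`):
`‖Δ • Σ_{i ≤ N} F(c + iΔ) − ∫_{T₁}^{T₂} F‖ ≤ Δ(3M₀ + ∫_{T₁}^{T₂} ‖F′‖)` — `N` cells at `Δ·∫_{cell}‖F′‖` each, the last node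
and the two ragged ends at `Δ·M₀` each. [cite: Apostol1976, Thm 3.1 p. 54 (proof)] -/
theorem norm_smul_sum_range_sub_integral_le {F F' : ℝ → E} {T₁ T₂ Δ c M₀ : ℝ} {N : ℕ} (hΔ : 0 < Δ)
    (hc₁ : T₁ ≤ c) (hc₁' : c ≤ T₁ + Δ) (hc₂ : c + N * Δ ≤ T₂) (hc₂' : T₂ ≤ c + N * Δ + Δ)
    (hF : ContinuousOn F (Set.Icc T₁ T₂)) (hF' : ∀ t ∈ Set.Ioo T₁ T₂, HasDerivWithinAt F (F' t) (Set.Ioi t) t)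
    (hint : IntervalIntegrable F' volume T₁ T₂) (hM : ∀ t ∈ Set.Icc T₁ T₂, ‖F t‖ ≤ M₀) :
    ‖Δ • ∑ i ∈ Finset.range (N + 1), F (c + i * Δ) - ∫ t in T₁..T₂, F t‖
      ≤ Δ * (3 * M₀ + ∫ t in T₁..T₂, ‖F' t‖) := by
  set s : ℕ → ℝ := fun i => c + i * Δ with hs
  have hs0 : s 0 = c := by simp [hs]
  have hstep : ∀ i, s (i + 1) = s i + Δ := fun i => by simp only [hs]; push_cast; ring
  have hs_mono : Monotone s := by
    refine monotone_nat_of_le_succ fun i => ?_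
    rw [hstep]; linarith
  have hsN : s N ≤ T₂ := hc₂
  have hsI : ∀ i ≤ N, s i ∈ Set.Icc T₁ T₂ := fun i hi =>
    ⟨hc₁.trans (hs0 ▸ hs_mono (Nat.zero_le i)), (hs_mono hi).trans hsN⟩
  have hM0 : 0 ≤ M₀ := (norm_nonneg _).trans (hM c ⟨hc₁, by simpa [hs0] using (hsI 0 (Nat.zero_le _)).2⟩)
  have hT : T₁ ≤ T₂ := by
    have h := (hsI 0 (Nat.zero_le _)).2
    rw [hs0] at h
    exact hc₁.trans h
  -- integrability on sub-intervals of the window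
  have hFi : ∀ u v, u ∈ Set.Icc T₁ T₂ → v ∈ Set.Icc T₁ T₂ → IntervalIntegrable F volume u v :=
    fun u v hu hv => (hF.mono (Set.uIcc_subset_Icc hu hv)).intervalIntegrable
  have hnint : IntervalIntegrable (fun t => ‖F' t‖) volume T₁ T₂ := hint.norm
  have hnint' : ∀ u v, u ∈ Set.Icc T₁ T₂ → v ∈ Set.Icc T₁ T₂ →
      IntervalIntegrable (fun t => ‖F' t‖) volume u v :=
    fun u v hu hv => hnint.mono_set (by rw [Set.uIcc_of_le hT]; exact Set.uIcc_subset_Icc hu hv)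
  -- split the integral: `∫_{T₁}^{T₂} = ∫_{T₁}^{s 0} + Σ_{i<N} ∫_{s i}^{s (i+1)} + ∫_{s N}^{T₂}`
  have hT₁I : T₁ ∈ Set.Icc T₁ T₂ := ⟨le_rfl, hT⟩
  have hT₂I : T₂ ∈ Set.Icc T₁ T₂ := ⟨hT, le_rfl⟩
  have hsplit : ∫ t in T₁..T₂, F t
      = (∫ t in T₁..s 0, F t) + (∑ i ∈ Finset.range N, ∫ t in s i..s (i + 1), F t) + ∫ t in s N..T₂, F t := by
    rw [sum_integral_adjacent_intervals fun k hk =>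
        hFi _ _ (hsI k hk.le) (hsI (k + 1) (Nat.succ_le_of_lt hk)),
      integral_add_adjacent_intervals (hFi _ _ hT₁I (hsI 0 (Nat.zero_le _)))
        (hFi _ _ (hsI 0 (Nat.zero_le _)) (hsI N le_rfl)),
      integral_add_adjacent_intervals (hFi _ _ hT₁I (hsI N le_rfl)) (hFi _ _ (hsI N le_rfl) hT₂I)]
  -- split the sum: `Σ_{i ≤ N} = Σ_{i < N} + F(s N)`
  have hsum : Δ • ∑ i ∈ Finset.range (N + 1), F (c + i * Δ)
      = (∑ i ∈ Finset.range N, Δ • F (s i)) + Δ • F (s N) := by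
    rw [Finset.sum_range_succ, smul_add, Finset.smul_sum]
  rw [hsum, hsplit]
  have hrearr : (∑ i ∈ Finset.range N, Δ • F (s i)) + Δ • F (s N)
      - ((∫ t in T₁..s 0, F t) + (∑ i ∈ Finset.range N, ∫ t in s i..s (i + 1), F t) + ∫ t in s N..T₂, F t)
      = (∑ i ∈ Finset.range N, (Δ • F (s i) - ∫ t in s i..s (i + 1), F t))
        + (Δ • F (s N) - (∫ t in T₁..s 0, F t) - ∫ t in s N..T₂, F t) := by
    rw [Finset.sum_sub_distrib]; abel
  rw [hrearr]
  -- the cells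
  have hcell : ∀ i ∈ Finset.range N,
      ‖Δ • F (s i) - ∫ t in s i..s (i + 1), F t‖ ≤ Δ * ∫ t in s i..s (i + 1), ‖F' t‖ := by
    intro i hi
    have hiN : i < N := Finset.mem_range.1 hi
    have h := norm_smul_sub_integral_cell_le (hsI i hiN.le).1 (hs_mono (Nat.le_add_right i 1))
      (hsI (i + 1) (Nat.succ_le_of_lt hiN)).2 hF hF' hint
    rw [hstep i, add_sub_cancel_left] at h
    rw [hstep i]
    exact h
  have hcells : ‖∑ i ∈ Finset.range N, (Δ • F (s i) - ∫ t in s i..s (i + 1), F t)‖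
      ≤ Δ * ∫ t in T₁..T₂, ‖F' t‖ := by
    calc ‖∑ i ∈ Finset.range N, (Δ • F (s i) - ∫ t in s i..s (i + 1), F t)‖
        ≤ ∑ i ∈ Finset.range N, ‖Δ • F (s i) - ∫ t in s i..s (i + 1), F t‖ := norm_sum_le _ _
      _ ≤ ∑ i ∈ Finset.range N, Δ * ∫ t in s i..s (i + 1), ‖F' t‖ := Finset.sum_le_sum hcell
      _ = Δ * ∫ t in s 0..s N, ‖F' t‖ := by
          rw [← Finset.mul_sum, sum_integral_adjacent_intervals fun k hk =>
            hnint' _ _ (hsI k hk.le) (hsI (k + 1) (Nat.succ_le_of_lt hk))]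
      _ ≤ Δ * ∫ t in T₁..T₂, ‖F' t‖ := by
          refine mul_le_mul_of_nonneg_left ?_ hΔ.le
          exact integral_mono_interval (hsI 0 (Nat.zero_le _)).1 (hs_mono (Nat.zero_le N)) hsN
            (Eventually.of_forall fun _ => norm_nonneg _) hnint
  -- the last node and the two ragged ends
  have hlast : ‖Δ • F (s N)‖ ≤ Δ * M₀ := by
    rw [norm_smul, Real.norm_of_nonneg hΔ.le]
    exact mul_le_mul_of_nonneg_left (hM _ (hsI N le_rfl)) hΔ.le
  have hleft : ‖∫ t in T₁..s 0, F t‖ ≤ Δ * M₀ := by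
    have h := intervalIntegral.norm_integral_le_of_norm_le_const (a := T₁) (b := s 0) (C := M₀)
      (f := F) fun t ht => hM t ?_
    · rw [abs_of_nonneg (by linarith [(hsI 0 (Nat.zero_le _)).1])] at h
      calc ‖∫ t in T₁..s 0, F t‖ ≤ M₀ * (s 0 - T₁) := h
        _ ≤ M₀ * Δ := mul_le_mul_of_nonneg_left (by rw [hs0]; linarith) hM0
        _ = Δ * M₀ := mul_comm _ _
    · rw [Set.uIoc_of_le (hsI 0 (Nat.zero_le _)).1] at ht
      exact ⟨ht.1.le, ht.2.trans (hsI 0 (Nat.zero_le _)).2⟩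
  have hright : ‖∫ t in s N..T₂, F t‖ ≤ Δ * M₀ := by
    have h := intervalIntegral.norm_integral_le_of_norm_le_const (a := s N) (b := T₂) (C := M₀)
      (f := F) fun t ht => hM t ?_
    · rw [abs_of_nonneg (by linarith [hsN])] at h
      calc ‖∫ t in s N..T₂, F t‖ ≤ M₀ * (T₂ - s N) := h
        _ ≤ M₀ * Δ := mul_le_mul_of_nonneg_left (by simp only [hs] at hc₂' ⊢; linarith) hM0
        _ = Δ * M₀ := mul_comm _ _
    · rw [Set.uIoc_of_le hsN] at ht
      exact ⟨(hsI N le_rfl).1.trans ht.1.le, ht.2⟩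
  calc ‖(∑ i ∈ Finset.range N, (Δ • F (s i) - ∫ t in s i..s (i + 1), F t))
        + (Δ • F (s N) - (∫ t in T₁..s 0, F t) - ∫ t in s N..T₂, F t)‖
      ≤ ‖∑ i ∈ Finset.range N, (Δ • F (s i) - ∫ t in s i..s (i + 1), F t)‖
        + ‖Δ • F (s N) - (∫ t in T₁..s 0, F t) - ∫ t in s N..T₂, F t‖ := norm_add_le _ _
    _ ≤ (Δ * ∫ t in T₁..T₂, ‖F' t‖) + (Δ * M₀ + Δ * M₀ + Δ * M₀) := by
        refine add_le_add hcells ?_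
        calc ‖Δ • F (s N) - (∫ t in T₁..s 0, F t) - ∫ t in s N..T₂, F t‖
            ≤ ‖Δ • F (s N) - ∫ t in T₁..s 0, F t‖ + ‖∫ t in s N..T₂, F t‖ := norm_sub_le _ _
          _ ≤ (‖Δ • F (s N)‖ + ‖∫ t in T₁..s 0, F t‖) + ‖∫ t in s N..T₂, F t‖ :=
              add_le_add (norm_sub_le _ _) le_rfl
          _ ≤ Δ * M₀ + Δ * M₀ + Δ * M₀ := add_le_add (add_le_add hlast hleft) hright
    _ = Δ * (3 * M₀ + ∫ t in T₁..T₂, ‖F' t‖) := by ring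

/-- Both window shapes at once: indices `k ∈ [a, b] ∩ ℤ` whose extreme nodes sit within `Δ` of the window's ends
(`T₁ − t₀ ≤ aΔ ≤ T₁ − t₀ + Δ`, `bΔ ≤ T₂ − t₀ ≤ bΔ + Δ`). [cite: Apostol1976, Thm 3.1 p. 54 (proof)] -/
private theorem norm_smul_sum_Icc_sub_integral_le {F F' : ℝ → E} {t₀ Δ T₁ T₂ M₀ : ℝ} {a b : ℤ} (hΔ : 0 < Δ)
    (hT : T₁ ≤ T₂) (h₁ : T₁ - t₀ ≤ a * Δ) (h₂ : a * Δ ≤ T₁ - t₀ + Δ) (h₃ : b * Δ ≤ T₂ - t₀)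
    (h₄ : T₂ - t₀ ≤ b * Δ + Δ) (hF : ContinuousOn F (Set.Icc T₁ T₂))
    (hF' : ∀ t ∈ Set.Ioo T₁ T₂, HasDerivWithinAt F (F' t) (Set.Ioi t) t)
    (hint : IntervalIntegrable F' volume T₁ T₂) (hM : ∀ t ∈ Set.Icc T₁ T₂, ‖F t‖ ≤ M₀) :
    ‖Δ • ∑ k ∈ Finset.Icc a b, F (t₀ + k * Δ) - ∫ t in T₁..T₂, F t‖
      ≤ Δ * (3 * M₀ + ∫ t in T₁..T₂, ‖F' t‖) := by
  have hM0 : 0 ≤ M₀ := (norm_nonneg _).trans (hM T₁ ⟨le_rfl, hT⟩)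
  have hI0 : 0 ≤ ∫ t in T₁..T₂, ‖F' t‖ := intervalIntegral.integral_nonneg hT fun _ _ => norm_nonneg _
  rcases lt_or_ge b a with hba | hab
  · -- no lattice point in the window, which is then no longer than `Δ`
    have hba' : (b : ℝ) + 1 ≤ a := by exact_mod_cast hba
    have hlen : T₂ - T₁ ≤ Δ := by nlinarith [mul_le_mul_of_nonneg_right hba' hΔ.le]
    rw [Finset.Icc_eq_empty_of_lt hba, Finset.sum_empty, smul_zero, zero_sub, norm_neg]
    have h := intervalIntegral.norm_integral_le_of_norm_le_const (a := T₁) (b := T₂) (C := M₀) (f := F)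
      fun t ht => hM t ?_
    · rw [abs_of_nonneg (sub_nonneg.2 hT)] at h
      calc ‖∫ t in T₁..T₂, F t‖ ≤ M₀ * (T₂ - T₁) := h
        _ ≤ M₀ * Δ := mul_le_mul_of_nonneg_left hlen hM0
        _ ≤ Δ * (3 * M₀ + ∫ t in T₁..T₂, ‖F' t‖) := by nlinarith [mul_nonneg hΔ.le hI0, mul_nonneg hΔ.le hM0]
    · rw [Set.uIoc_of_le hT] at ht
      exact ⟨ht.1.le, ht.2⟩
  · -- nodes `c + iΔ`, `i = 0, …, N`, with `c = t₀ + aΔ`, `N = b − a`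
    obtain ⟨N, hN⟩ : ∃ N : ℕ, b = a + N := ⟨(b - a).toNat, by omega⟩
    have hNr : (N : ℝ) = b - a := by rw [hN]; push_cast; ring
    have hsum : ∑ k ∈ Finset.Icc a b, F (t₀ + k * Δ)
        = ∑ i ∈ Finset.range (N + 1), F ((t₀ + a * Δ) + i * Δ) := by
      rw [Int.Icc_eq_finset_map, Finset.sum_map, show (b + 1 - a).toNat = N + 1 by omega]
      refine Finset.sum_congr rfl fun i _ => ?_
      simp only [Function.Embedding.trans_apply, Nat.castEmbedding_apply, addLeftEmbedding_apply]
      congr 1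
      push_cast
      ring
    rw [hsum]
    refine norm_smul_sum_range_sub_integral_le hΔ (by linarith) (by linarith) ?_ ?_ hF hF' hint hM
    · rw [hNr]; linarith
    · rw [hNr]; linarith

/-! ### The main inequality: closed and half-open windows -/

/-- **Lattice sums over a closed window against the integral — Euler's summation formula as an inequality, spacing
`Δ`.** For `Δ > 0`, `T₁ ≤ T₂`, `F : ℝ → E` continuous on `[T₁, T₂]` with a right derivative `F′ t` at every
`t ∈ (T₁, T₂)`, `F′` integrable on `[T₁, T₂]`, and `‖F‖ ≤ M₀` on `[T₁, T₂]`: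
`‖Δ • Σ_{k ∈ ℤ : T₁ ≤ t₀ + kΔ ≤ T₂} F(t₀ + kΔ) − ∫_{T₁}^{T₂} F‖ ≤ Δ·(3M₀ + ∫_{T₁}^{T₂} ‖F′‖)`. For `Δ = 1`, `t₀ = 0`,
real `F` this is read off Euler's summation formula (`0 ≤ t − [t] < 1`; the closed window may hold one more node than
Apostol's `(y, x]`, whence `3M₀`); complex/vector values and general `(Δ, t₀)` by the same telescoping.
[cite: Apostol1976, Thm 3.1 p. 54] -/
theorem norm_smul_sum_latticeWindow_sub_integral_le {F F' : ℝ → E} {t₀ Δ T₁ T₂ M₀ : ℝ} (hΔ : 0 < Δ)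
    (hT : T₁ ≤ T₂) (hF : ContinuousOn F (Set.Icc T₁ T₂))
    (hF' : ∀ t ∈ Set.Ioo T₁ T₂, HasDerivWithinAt F (F' t) (Set.Ioi t) t)
    (hint : IntervalIntegrable F' volume T₁ T₂) (hM : ∀ t ∈ Set.Icc T₁ T₂, ‖F t‖ ≤ M₀) :
    ‖Δ • ∑ k ∈ latticeWindow t₀ Δ T₁ T₂, F (t₀ + k * Δ) - ∫ t in T₁..T₂, F t‖
      ≤ Δ * (3 * M₀ + ∫ t in T₁..T₂, ‖F' t‖) := by
  have ha₁ : (T₁ - t₀) / Δ ≤ (⌈(T₁ - t₀) / Δ⌉ : ℝ) := Int.le_ceil _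
  have ha₂ : (⌈(T₁ - t₀) / Δ⌉ : ℝ) < (T₁ - t₀) / Δ + 1 := Int.ceil_lt_add_one _
  have hb₁ : (⌊(T₂ - t₀) / Δ⌋ : ℝ) ≤ (T₂ - t₀) / Δ := Int.floor_le _
  have hb₂ : (T₂ - t₀) / Δ < ⌊(T₂ - t₀) / Δ⌋ + 1 := Int.lt_floor_add_one _
  rw [div_le_iff₀ hΔ] at ha₁
  rw [← sub_lt_iff_lt_add, lt_div_iff₀ hΔ] at ha₂
  rw [le_div_iff₀ hΔ] at hb₁
  rw [div_lt_iff₀ hΔ] at hb₂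
  exact norm_smul_sum_Icc_sub_integral_le hΔ hT ha₁ (by linarith) hb₁ (by linarith) hF hF' hint hM

/-- **The half-open window** `(T₁, T₂]`: the same bound for `Σ_{k : T₁ < t₀ + kΔ ≤ T₂}` (Apostol's `Σ_{y < n ≤ x}` at
`Δ = 1`); half-open windows tile (`sum_latticeWindowIoc_add_sum_latticeWindowIoc`). [cite: Apostol1976, Thm 3.1 p. 54] -/
theorem norm_smul_sum_latticeWindowIoc_sub_integral_le {F F' : ℝ → E} {t₀ Δ T₁ T₂ M₀ : ℝ} (hΔ : 0 < Δ)
    (hT : T₁ ≤ T₂) (hF : ContinuousOn F (Set.Icc T₁ T₂))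
    (hF' : ∀ t ∈ Set.Ioo T₁ T₂, HasDerivWithinAt F (F' t) (Set.Ioi t) t)
    (hint : IntervalIntegrable F' volume T₁ T₂) (hM : ∀ t ∈ Set.Icc T₁ T₂, ‖F t‖ ≤ M₀) :
    ‖Δ • ∑ k ∈ latticeWindowIoc t₀ Δ T₁ T₂, F (t₀ + k * Δ) - ∫ t in T₁..T₂, F t‖
      ≤ Δ * (3 * M₀ + ∫ t in T₁..T₂, ‖F' t‖) := by
  have ha₁ : (⌊(T₁ - t₀) / Δ⌋ : ℝ) ≤ (T₁ - t₀) / Δ := Int.floor_le _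
  have ha₂ : (T₁ - t₀) / Δ < ⌊(T₁ - t₀) / Δ⌋ + 1 := Int.lt_floor_add_one _
  have hb₁ : (⌊(T₂ - t₀) / Δ⌋ : ℝ) ≤ (T₂ - t₀) / Δ := Int.floor_le _
  have hb₂ : (T₂ - t₀) / Δ < ⌊(T₂ - t₀) / Δ⌋ + 1 := Int.lt_floor_add_one _
  rw [le_div_iff₀ hΔ] at ha₁ hb₁
  rw [div_lt_iff₀ hΔ] at ha₂ hb₂
  refine norm_smul_sum_Icc_sub_integral_le hΔ hT ?_ ?_ hb₁ (by linarith) hF hF' hint hM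
  · push_cast; linarith
  · push_cast; linarith

/-! ### Corollaries: bounded derivative, the sum against `Δ⁻¹ • ∫`, the number of lattice points -/

/-- **Bounded-derivative form**: if moreover `‖F′‖ ≤ M₁` on `(T₁, T₂)`, the error is `≤ Δ·(3M₀ + (T₂ − T₁)M₁)` — the
shape `C·(sup ‖F‖ + (T₂ − T₁)·sup ‖F′‖)` (Davis–Rabinowitz (2.1.8) in window form). [cite: Apostol1976, Thm 3.1 p. 54] -/
theorem norm_smul_sum_latticeWindow_sub_integral_le_of_norm_deriv_le {F F' : ℝ → E} {t₀ Δ T₁ T₂ M₀ M₁ : ℝ}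
    (hΔ : 0 < Δ) (hT : T₁ ≤ T₂) (hF : ContinuousOn F (Set.Icc T₁ T₂))
    (hF' : ∀ t ∈ Set.Ioo T₁ T₂, HasDerivWithinAt F (F' t) (Set.Ioi t) t)
    (hint : IntervalIntegrable F' volume T₁ T₂) (hM : ∀ t ∈ Set.Icc T₁ T₂, ‖F t‖ ≤ M₀)
    (hM₁ : ∀ t ∈ Set.Ioo T₁ T₂, ‖F' t‖ ≤ M₁) :
    ‖Δ • ∑ k ∈ latticeWindow t₀ Δ T₁ T₂, F (t₀ + k * Δ) - ∫ t in T₁..T₂, F t‖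
      ≤ Δ * (3 * M₀ + (T₂ - T₁) * M₁) := by
  have hI : ∫ t in T₁..T₂, ‖F' t‖ ≤ (T₂ - T₁) * M₁ := by
    have h := intervalIntegral.integral_mono_on_of_le_Ioo hT hint.norm intervalIntegrable_const hM₁
    rwa [intervalIntegral.integral_const, smul_eq_mul] at h
  refine (norm_smul_sum_latticeWindow_sub_integral_le hΔ hT hF hF' hint hM).trans ?_
  exact mul_le_mul_of_nonneg_left (by linarith) hΔ.le

/-- **The sum against `Δ⁻¹ • ∫`**: `‖Σ_{k : T₁ ≤ t₀+kΔ ≤ T₂} F(t₀ + kΔ) − Δ⁻¹ • ∫_{T₁}^{T₂} F‖ ≤ 3M₀ + ∫_{T₁}^{T₂} ‖F′‖` —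
the number of nodes is `≈ (T₂ − T₁)/Δ`, so this is the statement «sum = density × integral + O(sup + variation)».
[cite: Apostol1976, Thm 3.1 p. 54] -/
theorem norm_sum_latticeWindow_sub_inv_smul_integral_le {F F' : ℝ → E} {t₀ Δ T₁ T₂ M₀ : ℝ} (hΔ : 0 < Δ)
    (hT : T₁ ≤ T₂) (hF : ContinuousOn F (Set.Icc T₁ T₂))
    (hF' : ∀ t ∈ Set.Ioo T₁ T₂, HasDerivWithinAt F (F' t) (Set.Ioi t) t)
    (hint : IntervalIntegrable F' volume T₁ T₂) (hM : ∀ t ∈ Set.Icc T₁ T₂, ‖F t‖ ≤ M₀) :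
    ‖∑ k ∈ latticeWindow t₀ Δ T₁ T₂, F (t₀ + k * Δ) - Δ⁻¹ • ∫ t in T₁..T₂, F t‖
      ≤ 3 * M₀ + ∫ t in T₁..T₂, ‖F' t‖ := by
  have h := norm_smul_sum_latticeWindow_sub_integral_le (t₀ := t₀) hΔ hT hF hF' hint hM
  have hrw : ∑ k ∈ latticeWindow t₀ Δ T₁ T₂, F (t₀ + k * Δ) - Δ⁻¹ • ∫ t in T₁..T₂, F t
      = Δ⁻¹ • (Δ • ∑ k ∈ latticeWindow t₀ Δ T₁ T₂, F (t₀ + k * Δ) - ∫ t in T₁..T₂, F t) := by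
    rw [smul_sub, smul_smul, inv_mul_cancel₀ hΔ.ne', one_smul]
  rw [hrw, norm_smul, norm_inv, Real.norm_of_nonneg hΔ.le]
  calc Δ⁻¹ * ‖Δ • ∑ k ∈ latticeWindow t₀ Δ T₁ T₂, F (t₀ + k * Δ) - ∫ t in T₁..T₂, F t‖
      ≤ Δ⁻¹ * (Δ * (3 * M₀ + ∫ t in T₁..T₂, ‖F' t‖)) := mul_le_mul_of_nonneg_left h (inv_nonneg.2 hΔ.le)
    _ = 3 * M₀ + ∫ t in T₁..T₂, ‖F' t‖ := by rw [← mul_assoc, inv_mul_cancel₀ hΔ.ne', one_mul]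

/-- **The number of lattice points of a closed window**: `|Δ·#{k : T₁ ≤ t₀ + kΔ ≤ T₂} − (T₂ − T₁)| ≤ 3Δ` (the main
inequality for `F ≡ 1`). [cite: Apostol1976, Thm 3.1 p. 54] -/
theorem abs_mul_card_latticeWindow_sub_le {t₀ Δ T₁ T₂ : ℝ} (hΔ : 0 < Δ) (hT : T₁ ≤ T₂) :
    |Δ * #(latticeWindow t₀ Δ T₁ T₂) - (T₂ - T₁)| ≤ 3 * Δ := by
  have h := norm_smul_sum_latticeWindow_sub_integral_le (E := ℝ) (F := fun _ => (1 : ℝ)) (F' := fun _ => 0)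
    (t₀ := t₀) (M₀ := 1) hΔ hT continuousOn_const (fun t _ => (hasDerivAt_const t (1 : ℝ)).hasDerivWithinAt)
    intervalIntegrable_const (fun _ _ => by simp)
  rw [show (3 : ℝ) * Δ = Δ * 3 from mul_comm _ _]
  simpa [Finset.sum_const, nsmul_eq_mul, intervalIntegral.integral_const, Real.norm_eq_abs] using h

/-- The count from above: `#{k : T₁ ≤ t₀ + kΔ ≤ T₂} ≤ (T₂ − T₁)/Δ + 1` (`T₁ ≤ T₂`; `[x] − [y] ≤ x − y + 1`).
[cite: Apostol1976, Thm 3.1 p. 54 (proof)] -/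
theorem card_latticeWindow_le {t₀ Δ T₁ T₂ : ℝ} (hΔ : 0 < Δ) (hT : T₁ ≤ T₂) :
    (#(latticeWindow t₀ Δ T₁ T₂) : ℝ) ≤ (T₂ - T₁) / Δ + 1 := by
  rw [latticeWindow, Int.card_Icc]
  have ha : (T₁ - t₀) / Δ ≤ (⌈(T₁ - t₀) / Δ⌉ : ℝ) := Int.le_ceil _
  have hb : (⌊(T₂ - t₀) / Δ⌋ : ℝ) ≤ (T₂ - t₀) / Δ := Int.floor_le _
  have hdiv : (T₂ - T₁) / Δ = (T₂ - t₀) / Δ - (T₁ - t₀) / Δ := by field_simp; ring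
  have hnn : 0 ≤ (T₂ - T₁) / Δ := div_nonneg (sub_nonneg.2 hT) hΔ.le
  rcases le_or_gt 0 (⌊(T₂ - t₀) / Δ⌋ + 1 - ⌈(T₁ - t₀) / Δ⌉) with h | h
  · rw [show (((⌊(T₂ - t₀) / Δ⌋ + 1 - ⌈(T₁ - t₀) / Δ⌉).toNat : ℕ) : ℝ)
        = ((⌊(T₂ - t₀) / Δ⌋ + 1 - ⌈(T₁ - t₀) / Δ⌉ : ℤ) : ℝ) by exact_mod_cast Int.toNat_of_nonneg h]
    push_cast
    linarith
  · rw [Int.toNat_eq_zero.2 h.le]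
    push_cast
    linarith

/-- The count from below: `(T₂ − T₁)/Δ − 1 ≤ #{k : T₁ ≤ t₀ + kΔ ≤ T₂}` (`[x] − [y] ≥ x − y − 1`).
[cite: Apostol1976, Thm 3.1 p. 54 (proof)] -/
theorem sub_one_le_card_latticeWindow {t₀ Δ T₁ T₂ : ℝ} (hΔ : 0 < Δ) :
    (T₂ - T₁) / Δ - 1 ≤ (#(latticeWindow t₀ Δ T₁ T₂) : ℝ) := by
  rw [latticeWindow, Int.card_Icc]
  have ha : (⌈(T₁ - t₀) / Δ⌉ : ℝ) < (T₁ - t₀) / Δ + 1 := Int.ceil_lt_add_one _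
  have hb : (T₂ - t₀) / Δ < ⌊(T₂ - t₀) / Δ⌋ + 1 := Int.lt_floor_add_one _
  have hdiv : (T₂ - T₁) / Δ = (T₂ - t₀) / Δ - (T₁ - t₀) / Δ := by field_simp; ring
  have hle : ((⌊(T₂ - t₀) / Δ⌋ + 1 - ⌈(T₁ - t₀) / Δ⌉ : ℤ) : ℝ)
      ≤ (((⌊(T₂ - t₀) / Δ⌋ + 1 - ⌈(T₁ - t₀) / Δ⌉).toNat : ℕ) : ℝ) := by exact_mod_cast Int.self_le_toNat _
  push_cast at hle
  linarith

/-! ### Unit spacing: sums over the positive integers `n ≤ x` (Apostol's form) -/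

/-- `{1, …, N} ⊂ ℕ` cast into `ℤ` is `{1, …, N} ⊂ ℤ`. [folklore] -/
private theorem map_natCast_Icc_one (N : ℕ) :
    (Finset.Icc 1 N).map Nat.castEmbedding = Finset.Icc (1 : ℤ) N := by
  ext x
  simp only [Finset.mem_map, Finset.mem_Icc, Nat.castEmbedding_apply]
  constructor
  · rintro ⟨n, ⟨h1, h2⟩, rfl⟩
    exact ⟨by exact_mod_cast h1, by exact_mod_cast h2⟩
  · rintro ⟨h1, h2⟩
    exact ⟨x.toNat, ⟨by omega, by omega⟩, Int.toNat_of_nonneg (by omega)⟩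

/-- **Sums over the integers `1 ≤ n ≤ x` — Euler's summation formula as an inequality, unit spacing**: for `x ≥ 1`,
`F` continuous on `[1, x]` with an integrable right derivative on `(1, x)` and `‖F‖ ≤ M₀` on `[1, x]`:
`‖Σ_{1 ≤ n ≤ x} F(n) − ∫_1^x F‖ ≤ 3M₀ + ∫_1^x ‖F′‖` (Apostol's (5) gives `|f(x)| + |f(y)| + ∫|f′|` for the half-open
`y < n ≤ x`; the closed range may hold the extra node `n = 1`). [cite: Apostol1976, Thm 3.1 p. 54] -/
theorem norm_sum_Icc_floor_sub_integral_le {F F' : ℝ → E} {x M₀ : ℝ} (hx : 1 ≤ x)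
    (hF : ContinuousOn F (Set.Icc 1 x)) (hF' : ∀ t ∈ Set.Ioo 1 x, HasDerivWithinAt F (F' t) (Set.Ioi t) t)
    (hint : IntervalIntegrable F' volume 1 x) (hM : ∀ t ∈ Set.Icc 1 x, ‖F t‖ ≤ M₀) :
    ‖∑ n ∈ Finset.Icc 1 ⌊x⌋₊, F n - ∫ t in (1 : ℝ)..x, F t‖ ≤ 3 * M₀ + ∫ t in (1 : ℝ)..x, ‖F' t‖ := by
  have h := norm_sum_latticeWindow_sub_inv_smul_integral_le (t₀ := 0) one_pos hx hF hF' hint hM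
  have hW : latticeWindow 0 1 1 x = Finset.Icc (1 : ℤ) ⌊x⌋₊ := by
    rw [latticeWindow, sub_zero, sub_zero, div_one, div_one, Int.ceil_one,
      Int.natCast_floor_eq_floor (by linarith)]
  rw [hW, ← map_natCast_Icc_one, Finset.sum_map, inv_one, one_smul] at h
  simpa using h

/-! ### Limit forms: a sequence of lattices with spacings `Δ_n → 0` and arbitrary offsets -/

/-- **Riemann-sum limit over shrinking lattices, fixed integrand**: for `F` as in the main inequality and any offsets
`t₀(n)`, spacings `Δ_n > 0`, `Δ_n → 0`: `Δ_n • Σ_{k : T₁ ≤ t₀(n) + kΔ_n ≤ T₂} F(t₀(n) + kΔ_n) → ∫_{T₁}^{T₂} F`.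
[cite: Apostol1976, Thm 3.1 p. 54] -/
theorem tendsto_smul_sum_latticeWindow {F F' : ℝ → E} {T₁ T₂ : ℝ} (hT : T₁ ≤ T₂)
    (hF : ContinuousOn F (Set.Icc T₁ T₂)) (hF' : ∀ t ∈ Set.Ioo T₁ T₂, HasDerivWithinAt F (F' t) (Set.Ioi t) t)
    (hint : IntervalIntegrable F' volume T₁ T₂) {Δ t₀ : ℕ → ℝ} (hΔ : ∀ n, 0 < Δ n)
    (hΔ0 : Tendsto Δ atTop (𝓝 0)) :
    Tendsto (fun n => Δ n • ∑ k ∈ latticeWindow (t₀ n) (Δ n) T₁ T₂, F (t₀ n + k * Δ n)) atTop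
      (𝓝 (∫ t in T₁..T₂, F t)) := by
  obtain ⟨M₀, hM⟩ := isCompact_Icc.exists_bound_of_continuousOn hF
  rw [tendsto_iff_norm_sub_tendsto_zero]
  have hC : Tendsto (fun n => Δ n * (3 * M₀ + ∫ t in T₁..T₂, ‖F' t‖)) atTop (𝓝 0) := by
    simpa using hΔ0.mul_const (3 * M₀ + ∫ t in T₁..T₂, ‖F' t‖)
  exact squeeze_zero (fun _ => norm_nonneg _)
    (fun n => norm_smul_sum_latticeWindow_sub_integral_le (hΔ n) hT hF hF' hint hM) hC

/-- **Stage-dependent integrands with uniform bounds**: if `‖F_n‖ ≤ M₀` on `[T₁, T₂]` and `∫_{T₁}^{T₂} ‖F_n′‖ ≤ V` for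
all `n`, then `Δ_n • Σ_{window} F_n(nodes) − ∫_{T₁}^{T₂} F_n → 0` as `Δ_n → 0⁺` (offsets arbitrary) — the uniformity is
free from the explicit inequality. [cite: Apostol1976, Thm 3.1 p. 54] -/
theorem tendsto_smul_sum_latticeWindow_sub_integral {F F' : ℕ → ℝ → E} {T₁ T₂ M₀ V : ℝ} (hT : T₁ ≤ T₂)
    (hF : ∀ n, ContinuousOn (F n) (Set.Icc T₁ T₂))
    (hF' : ∀ n, ∀ t ∈ Set.Ioo T₁ T₂, HasDerivWithinAt (F n) (F' n t) (Set.Ioi t) t)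
    (hint : ∀ n, IntervalIntegrable (F' n) volume T₁ T₂) (hM : ∀ n, ∀ t ∈ Set.Icc T₁ T₂, ‖F n t‖ ≤ M₀)
    (hV : ∀ n, ∫ t in T₁..T₂, ‖F' n t‖ ≤ V) {Δ t₀ : ℕ → ℝ} (hΔ : ∀ n, 0 < Δ n)
    (hΔ0 : Tendsto Δ atTop (𝓝 0)) :
    Tendsto (fun n => Δ n • ∑ k ∈ latticeWindow (t₀ n) (Δ n) T₁ T₂, F n (t₀ n + k * Δ n)
      - ∫ t in T₁..T₂, F n t) atTop (𝓝 0) := by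
  rw [tendsto_zero_iff_norm_tendsto_zero]
  have hC : Tendsto (fun n => Δ n * (3 * M₀ + V)) atTop (𝓝 0) := by
    simpa using hΔ0.mul_const (3 * M₀ + V)
  refine squeeze_zero (fun _ => norm_nonneg _) (fun n => ?_) hC
  refine (norm_smul_sum_latticeWindow_sub_integral_le (hΔ n) hT (hF n) (hF' n) (hint n) (hM n)).trans ?_
  exact mul_le_mul_of_nonneg_left (by linarith [hV n]) (hΔ n).le

/-- **Normalised by the number of nodes**: under the same uniform bounds and `T₁ < T₂`,
`(#W_n)⁻¹ • Σ_{k ∈ W_n} F_n(nodes) − (T₂ − T₁)⁻¹ • ∫_{T₁}^{T₂} F_n → 0` (`W_n` the index window at stage `n`): the discrete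
average over the lattice points of the window and the continuous average agree in the limit `Δ_n → 0⁺`.
[cite: Apostol1976, Thm 3.1 p. 54] -/
theorem tendsto_average_latticeWindow_sub {F F' : ℕ → ℝ → E} {T₁ T₂ M₀ V : ℝ} (hT : T₁ < T₂)
    (hF : ∀ n, ContinuousOn (F n) (Set.Icc T₁ T₂))
    (hF' : ∀ n, ∀ t ∈ Set.Ioo T₁ T₂, HasDerivWithinAt (F n) (F' n t) (Set.Ioi t) t)
    (hint : ∀ n, IntervalIntegrable (F' n) volume T₁ T₂) (hM : ∀ n, ∀ t ∈ Set.Icc T₁ T₂, ‖F n t‖ ≤ M₀)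
    (hV : ∀ n, ∫ t in T₁..T₂, ‖F' n t‖ ≤ V) {Δ t₀ : ℕ → ℝ} (hΔ : ∀ n, 0 < Δ n)
    (hΔ0 : Tendsto Δ atTop (𝓝 0)) :
    Tendsto (fun n => (#(latticeWindow (t₀ n) (Δ n) T₁ T₂) : ℝ)⁻¹
        • ∑ k ∈ latticeWindow (t₀ n) (Δ n) T₁ T₂, F n (t₀ n + k * Δ n)
      - (T₂ - T₁)⁻¹ • ∫ t in T₁..T₂, F n t) atTop (𝓝 0) := by
  have hL0 : 0 < T₂ - T₁ := sub_pos.2 hT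
  -- `c n := Δ_n · #W_n → T₂ − T₁`
  have hcL : Tendsto (fun n => Δ n * #(latticeWindow (t₀ n) (Δ n) T₁ T₂)) atTop (𝓝 (T₂ - T₁)) := by
    rw [tendsto_iff_norm_sub_tendsto_zero]
    have h3 : Tendsto (fun n => 3 * Δ n) atTop (𝓝 0) := by simpa using hΔ0.const_mul 3
    exact squeeze_zero (fun _ => norm_nonneg _)
      (fun n => by rw [Real.norm_eq_abs]; exact abs_mul_card_latticeWindow_sub_le (hΔ n) hT.le) h3
  have hcinv : Tendsto (fun n => (Δ n * #(latticeWindow (t₀ n) (Δ n) T₁ T₂))⁻¹) atTop (𝓝 (T₂ - T₁)⁻¹) :=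
    hcL.inv₀ hL0.ne'
  -- `A n − I n → 0`
  have hAI := tendsto_smul_sum_latticeWindow_sub_integral (t₀ := t₀) hT.le hF hF' hint hM hV hΔ hΔ0
  -- `‖I n‖` bounded
  have hIb : ∀ n, ‖∫ t in T₁..T₂, F n t‖ ≤ M₀ * (T₂ - T₁) := by
    intro n
    have h := intervalIntegral.norm_integral_le_of_norm_le_const (a := T₁) (b := T₂) (C := M₀) (f := F n)
      fun t ht => hM n t ?_
    · rwa [abs_of_pos hL0] at h
    · rw [Set.uIoc_of_le hT.le] at ht
      exact ⟨ht.1.le, ht.2⟩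
  -- the two pieces
  have h1 : Tendsto (fun n => (Δ n * #(latticeWindow (t₀ n) (Δ n) T₁ T₂))⁻¹
      • (Δ n • ∑ k ∈ latticeWindow (t₀ n) (Δ n) T₁ T₂, F n (t₀ n + k * Δ n) - ∫ t in T₁..T₂, F n t))
      atTop (𝓝 0) := by
    simpa using hcinv.smul hAI
  have h2 : Tendsto (fun n => ((Δ n * #(latticeWindow (t₀ n) (Δ n) T₁ T₂))⁻¹ - (T₂ - T₁)⁻¹)
      • ∫ t in T₁..T₂, F n t) atTop (𝓝 0) := by
    have h0 : Tendsto (fun n => (Δ n * #(latticeWindow (t₀ n) (Δ n) T₁ T₂))⁻¹ - (T₂ - T₁)⁻¹) atTop (𝓝 0) := by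
      simpa using hcinv.sub_const (T₂ - T₁)⁻¹
    exact h0.zero_smul_isBoundedUnder_le (Filter.isBoundedUnder_of ⟨M₀ * (T₂ - T₁), fun n => hIb n⟩)
  have h12 := h1.add h2
  rw [add_zero] at h12
  refine Tendsto.congr (fun n => ?_) h12
  -- the algebra: `c⁻¹ • (A − I) + (c⁻¹ − L⁻¹) • I = (#W)⁻¹ • S − L⁻¹ • I`, `c⁻¹Δ = (#W)⁻¹`
  have hcΔ : (Δ n * #(latticeWindow (t₀ n) (Δ n) T₁ T₂))⁻¹ * Δ n
      = (#(latticeWindow (t₀ n) (Δ n) T₁ T₂) : ℝ)⁻¹ := by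
    rw [mul_inv, mul_comm (Δ n)⁻¹, mul_assoc, inv_mul_cancel₀ (hΔ n).ne', mul_one]
  rw [smul_sub, smul_smul, hcΔ, sub_smul]
  abel

end Literature.Analysis.Quadrature
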